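/-
Copyright: the b2b-balaban T⁴-continuum CRUX team, row NE7b leaf lineage `t4-ne7b-formalise-leaf-05` (gen 155). Project licence.
-/
import Summits.QuantumFields.BalabanUV.T4Continuum.Spine.NE7b.NonAbelianStokesRectScript

/-!
# (NAS) part 3¾ — SKYLINE REGIONS AS PLAQUETTE SCRIPTS: every histogram `{(i, j) : i < n, j < K i}` standing on the `κ`-axis (column heights
# `K : ℕ → ℕ` arbitrary — rectangles, staircases, L-shapes, combs) has a boundary word `skylineWord κ μ K n` BUILT by a script of
# `NonAbelianStokesDisc` inserting exactly its `Σ_{i<n} K i` plaquette contours, each once (row NE7b, node U5c; the sequel of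
# `NonAbelianStokesRectScript` asked for by the parent author leaf-01 g84, journal l.59497: «per-column heights `K_i` script every SKYLINE region …
# the row phase cancels `min(K_i, K_{i+1})` nested backtracks»)

Cell `pub-balaban`, sub-cell `t4`, spine estimate NE7b (`T4WeightBudget.RelWeightBound`; the cell's OWN estimate — NOT PRINTED in [Bałaban 1983–89], NOT PROVED).
Crux-route work under `Spine/NE7b/` by a row leaf; [folklore] list bookkeeping on lattice words; NOTHING of Bałaban's is named, asserted or valued; no
`T4Continuum/Support` leaf typed; THREE data definitions (`skylineTail`, `skylineWord` — the boundary word; `skylineScript` — the script; list-valued, no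
`Prop`-valued definition); zero `sorry`.  Imports this lineage's `NonAbelianStokesRectScript` ONLY (`colMoves`, `rowCancels`, `build_colMoves`, `build_rowCancels`,
`apply_backtrack_of_length`, `glued_colMoves_append`, `loops_…` BY NAME; through it leaf-01's `NonAbelianStokesDisc` and `NonAbelianStokesBound.rectWord`).

THE REGION AND ITS BOUNDARY WORD.  Columns `i = 0, …, n−1` of heights `K i` over the base point `x`: cells `x + ie_κ + je_μ`, `j < K i`.  The boundary, read
counter-clockwise from `x`: the bottom edge `κ^n`, up the last column `μ^{K(n−1)}`, then for `i = n−1, …, 1`: leftward across column `i`'s top (`κ⁻`) and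
VERTICALLY from height `K i` to height `K(i−1)` — `μ̄^{K i − min} μ^{K(i−1) − min}`, `min = min (K i) (K(i−1))`, one of the two empty —, finally `κ⁻` across
column `0`'s top and down `μ̄^{K 0}`.  DATA: `skylineTail K i` (the word after `κ^{i+1} μ^{K i}`), `skylineWord K n`.  For constant heights `K i = K` the
word with `n ≥ 1` columns is `NonAbelianStokesBound.rectWord κ μ n K` (`skylineWord_const`; at `n = 0` part 1 keeps the backtrack tower `μ^K μ̄^K`).

THE SCRIPT (`skylineScript`; head = applied LAST).  `n = 0`: nothing.  Column `n` on top of the region of the first `n` columns: a backtrack `κ⁺κ⁻` at position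
`n`; the COLUMN PHASE `colMoves κ μ n (K n)` of `NonAbelianStokesRectScript` (insert `∂p_{κμ}` at the corners `x + ne_κ + je_μ`, `j < K n`, growing the column
`κ⁺ μ^j κ⁻ μ̄^j`); the JUNCTION PHASE `rowCancels μ (n + 2·K n − m + 2) 0 m`, `m = min (K n) (K(n−1))` (`m = 0` for the first column): the `m` nested
backtracks `μ̄ μ` where the new column's descending side `μ̄^{K n}` meets the old last column's ascending side `μ^{K(n−1)}` cancel, leaving the vertical
connector `μ̄^{K n − m} μ^{K(n−1) − m}`.

WHAT IS PROVED ([folklore]):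
* §1 DATA + `skylineTail_zero ∕ _succ`, `skylineWord_zero ∕ _succ`, **`skylineWord_const`** (`K ≡ K₀`, `n + 1` columns ⟹ `skylineWord = rectWord κ μ (n+1) K₀`), `disp_skylineWord`
  (the word is closed).
* §2 **`build_skylineScript`** (`build (skylineScript κ μ K n) = skylineWord κ μ K n`, letter for letter).
* §3 **`loops_skylineScript`** (`= replicate (Σ_{i<n} K i) (plaqWord κ μ)`), `eq_plaqWord_of_mem_loops_skylineScript`, **`glued_skylineScript_zero ∕ _succ`** (column
  `n`'s `K n` corners prepended), **`sum_glued_skylineScript`** (`Σ_{glued} f = Σ_{i<n} Σ_{j<K i} f(x + ie_κ + je_μ, ∂p)`).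
* §4 (NAS) FOR SKYLINE REGIONS from part 3 BY NAME: **`dist1_hol_skylineWord_le_sum`** (`dist1 V(∂𝓡) ≤ Σ_{i<n} Σ_{j<K i} dist1 V(∂p(x + ie_κ + je_μ))`).
* §5 SANITY: the L-shape `K = (2, 1)` — word `κ κ μ κ̄ μ μ̄⁰… ` computed (`example`), and the staircase.

NOT HERE (honest): regions not standing on one axis-parallel base (general column-convex regions need a second skyline below — the same device twice),
regions with holes (not discs); the pair-level ∕ linearised reading (`LinearisedLatticeStokesDisc` applies verbatim to `skylineScript` — junction left to a
successor file once the oleans exist); which regions are Bałaban's ((A3) ∕ (A1c), NC-NE7b-α UNRULED).  BY-NAME EFFECT ON THE WALL: NONE.  NE7b NOT PRINTED ∕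
NOT PROVED; spine PROVED 0∕9; rung (B)+1 on a FINITE torus — NOT infinite volume, NOT the mass gap, NOT Clay.  HONEST DEPENDENCY: continuum YM on T⁴ ⇐
BetaPertH ∧ nine spine estimates (0/9 proved); BetaPertH ⇐ (D1) ∧ (D4) ∧ CAP+tail; G-an2-4 gates asym, D1 and NE2/3/4.
-/

set_option autoImplicit false

open scoped BigOperators

namespace Summit.QuantumFields.BalabanUV.T4Continuum.NE7b.NonAbelianStokesSkylineScript

open Literature.MathematicalPhysics.QuantumFieldTheory.Balaban1983to89 (GaugeGroup dist1)
open Literature.MathematicalPhysics.QuantumFieldTheory.Balaban1983to89.B7Prop1Explicit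
  (Site Letter e disp disp_cons disp_append disp_replicate hol plaqWord disp_plaqWord seg seg_natCast seg_neg_natCast revWord revWord_seg)
open NonAbelianStokesBound (rectWord)
open NonAbelianStokesDisc
open NonAbelianStokesRectScript (colMoves rowCancels apply_backtrack_of_length build_colMoves build_rowCancels loops_colMoves_append
  loops_rowCancels_append glued_colMoves_append glued_rowCancels_append)

variable {d : ℕ}

/-! ## §1 The boundary word of a skyline region (DATA) -/

section Word

/-- DATA.  The part of the boundary word after `κ^{i+1} μ^{K i}`: across column `i`'s top, the vertical connector to height `K(i−1)`, …, across column `0`'s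
top and down to the base point. -/
def skylineTail (κ μ : Fin d) (K : ℕ → ℕ) : ℕ → List (Letter d)
  | 0 => (κ, false) :: List.replicate (K 0) (μ, false)
  | i + 1 => (κ, false) :: (List.replicate (K (i + 1) - min (K (i + 1)) (K i)) ((μ, false) : Letter d) ++
      (List.replicate (K i - min (K (i + 1)) (K i)) ((μ, true) : Letter d) ++ skylineTail κ μ K i))

/-- DATA.  THE BOUNDARY WORD of the skyline region with `n` columns of heights `K 0, …, K(n−1)` over the base point, counter-clockwise. -/
def skylineWord (κ μ : Fin d) (K : ℕ → ℕ) : ℕ → List (Letter d)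
  | 0 => []
  | i + 1 => List.replicate (i + 1) ((κ, true) : Letter d) ++ (List.replicate (K i) ((μ, true) : Letter d) ++ skylineTail κ μ K i)

/-- `skylineTail` at the first column. -/
theorem skylineTail_zero (κ μ : Fin d) (K : ℕ → ℕ) :
    skylineTail κ μ K 0 = (κ, false) :: List.replicate (K 0) ((μ, false) : Letter d) := rfl

/-- `skylineTail` recursion. -/
theorem skylineTail_succ (κ μ : Fin d) (K : ℕ → ℕ) (i : ℕ) :
    skylineTail κ μ K (i + 1) = (κ, false) :: (List.replicate (K (i + 1) - min (K (i + 1)) (K i)) ((μ, false) : Letter d) ++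
      (List.replicate (K i - min (K (i + 1)) (K i)) ((μ, true) : Letter d) ++ skylineTail κ μ K i)) := rfl

/-- The empty region has the empty boundary word. -/
theorem skylineWord_zero (κ μ : Fin d) (K : ℕ → ℕ) : skylineWord κ μ K 0 = ([] : List (Letter d)) := rfl

/-- `skylineWord` with `i + 1` columns. -/
theorem skylineWord_succ (κ μ : Fin d) (K : ℕ → ℕ) (i : ℕ) :
    skylineWord κ μ K (i + 1) =
      List.replicate (i + 1) ((κ, true) : Letter d) ++ (List.replicate (K i) ((μ, true) : Letter d) ++ skylineTail κ μ K i) := rfl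

/-- For CONSTANT heights the tail is `κ̄^{i+1} μ̄^{K₀}` … -/
theorem skylineTail_const (κ μ : Fin d) (K₀ : ℕ) : ∀ i : ℕ,
    skylineTail κ μ (fun _ => K₀) i = List.replicate (i + 1) ((κ, false) : Letter d) ++ List.replicate K₀ ((μ, false) : Letter d)
  | 0 => by rw [skylineTail_zero]; rfl
  | i + 1 => by
    have ih := skylineTail_const κ μ K₀ i
    simp only [skylineTail_succ, ih, min_self, Nat.sub_self, List.replicate_zero, List.nil_append]
    rfl

/-- **… so for CONSTANT heights the skyline word IS the coordinate rectangle word** `rectWord κ μ (n+1) K₀` of part 1 (for `n + 1 ≥ 1` columns; at ZERO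
columns the skyline word is empty while `rectWord κ μ 0 K₀ = μ^{K₀} μ̄^{K₀}` keeps part 1's degenerate backtrack tower). [folklore] -/
theorem skylineWord_const (κ μ : Fin d) (K₀ n : ℕ) : skylineWord κ μ (fun _ => K₀) (n + 1) = rectWord κ μ (n + 1) K₀ := by
  rw [skylineWord_succ, skylineTail_const, rectWord, revWord_seg, revWord_seg, seg_natCast, seg_natCast, seg_neg_natCast, seg_neg_natCast,
    List.append_assoc, List.append_assoc]

/-- The tail's displacement: from height `K i` above `x + (i+1)e_κ` back to `x`. -/
theorem disp_skylineTail (κ μ : Fin d) (K : ℕ → ℕ) : ∀ i : ℕ,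
    disp (skylineTail κ μ K i) = -(((i : ℤ) + 1) • e κ) - ((K i : ℕ) : ℤ) • e μ
  | 0 => by
    rw [skylineTail_zero, disp_cons, disp_replicate, Letter.vec_false, Letter.vec_false]
    push_cast; module
  | i + 1 => by
    have hmin1 : min (K (i + 1)) (K i) ≤ K (i + 1) := min_le_left _ _
    have hmin2 : min (K (i + 1)) (K i) ≤ K i := min_le_right _ _
    have e1 : ((K (i + 1) - min (K (i + 1)) (K i) : ℕ) : ℤ) = (K (i + 1) : ℤ) - (min (K (i + 1)) (K i) : ℕ) := Nat.cast_sub hmin1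
    have e2 : ((K i - min (K (i + 1)) (K i) : ℕ) : ℤ) = (K i : ℤ) - (min (K (i + 1)) (K i) : ℕ) := Nat.cast_sub hmin2
    rw [skylineTail_succ, disp_cons, disp_append, disp_append, disp_replicate, disp_replicate, disp_skylineTail κ μ K i,
      Letter.vec_false, Letter.vec_false, Letter.vec_true, e1, e2]
    push_cast; module

/-- **THE SKYLINE WORD IS CLOSED.** [folklore] -/
theorem disp_skylineWord (κ μ : Fin d) (K : ℕ → ℕ) : ∀ n : ℕ, disp (skylineWord κ μ K n) = 0
  | 0 => by rw [skylineWord_zero]; rfl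
  | i + 1 => by
    rw [skylineWord_succ, disp_append, disp_append, disp_replicate, disp_replicate, disp_skylineTail, Letter.vec_true, Letter.vec_true]
    push_cast; module

end Word

/-! ## §2 The script and what it builds -/

section Script

/-- DATA.  THE SKYLINE SCRIPT: column after column — a backtrack at position `n`, the column phase `colMoves κ μ n (K n)`, and the junction phase cancelling
`min (K n) (K(n−1))` nested backtracks (none for the first column). -/
def skylineScript (κ μ : Fin d) (K : ℕ → ℕ) : ℕ → List (Move d)
  | 0 => []
  | 1 => colMoves κ μ 0 (K 0) ++ [Move.backtrack 0 (κ, true)]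
  | i + 2 => rowCancels μ (i + 2 * K (i + 1) - min (K (i + 1)) (K i) + 3) 0 (min (K (i + 1)) (K i)) ++
      (colMoves κ μ (i + 1) (K (i + 1)) ++ (Move.backtrack (i + 1) (κ, true) :: skylineScript κ μ K (i + 1)))

/-- The one-column script. -/
theorem skylineScript_one (κ μ : Fin d) (K : ℕ → ℕ) :
    skylineScript κ μ K 1 = colMoves κ μ 0 (K 0) ++ [Move.backtrack 0 (κ, true)] := rfl

/-- The script's recursion from two columns on. -/
theorem skylineScript_succ_succ (κ μ : Fin d) (K : ℕ → ℕ) (i : ℕ) :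
    skylineScript κ μ K (i + 2) = rowCancels μ (i + 2 * K (i + 1) - min (K (i + 1)) (K i) + 3) 0 (min (K (i + 1)) (K i)) ++
      (colMoves κ μ (i + 1) (K (i + 1)) ++ (Move.backtrack (i + 1) (κ, true) :: skylineScript κ μ K (i + 1))) := rfl

/-- **THE SKYLINE SCRIPT BUILDS THE SKYLINE WORD, LETTER FOR LETTER.** [folklore] -/
theorem build_skylineScript (κ μ : Fin d) (K : ℕ → ℕ) : ∀ n : ℕ, build (skylineScript κ μ K n) = skylineWord κ μ K n
  | 0 => rfl
  | 1 => by
    -- the first column: backtrack at 0, then the column phase (no junction)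
    have h1 : build [Move.backtrack 0 ((κ, true) : Letter d)] = ([] : List (Letter d)) ++ ((κ, true) :: (κ, false) :: ([] : List (Letter d))) := by
      rw [build, build]; exact apply_backtrack_of_length _ [] [] rfl
    rw [skylineScript_one, build_colMoves κ μ (n := 0) [] [] rfl _ h1 (K 0), skylineWord_succ, skylineTail_zero]
    simp
  | i + 2 => by
    have ih := build_skylineScript κ μ K (i + 1)
    set m := min (K (i + 1)) (K i) with hm
    have hm1 : m ≤ K (i + 1) := min_le_left _ _
    have hm2 : m ≤ K i := min_le_right _ _
    -- (1) the backtrack at position `i + 1`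
    have h1 : build (Move.backtrack (i + 1) (κ, true) :: skylineScript κ μ K (i + 1)) =
        List.replicate (i + 1) ((κ, true) : Letter d) ++ ((κ, true) :: (κ, false) ::
          (List.replicate (K i) ((μ, true) : Letter d) ++ skylineTail κ μ K i)) := by
      rw [build, ih, skylineWord_succ, apply_backtrack_of_length _ _ _ (List.length_replicate ..)]
      rfl
    -- (2) the column phase at offset `i + 1`
    have h2 := build_colMoves κ μ (List.replicate (i + 1) ((κ, true) : Letter d))
      (List.replicate (K i) ((μ, true) : Letter d) ++ skylineTail κ μ K i) (List.length_replicate ..) _ h1 (K (i + 1))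
    -- (3) the junction phase: split `μ̄^{K(i+1)} = μ̄^{K(i+1)−m} μ̄^m` and `μ^{K i} = μ^m μ^{K i − m}`
    have hsplit1 : List.replicate (K (i + 1)) ((μ, false) : Letter d) =
        List.replicate (K (i + 1) - m) ((μ, false) : Letter d) ++ List.replicate m ((μ, false) : Letter d) := by
      rw [← List.replicate_add, Nat.sub_add_cancel hm1]
    have hsplit2 : List.replicate (K i) ((μ, true) : Letter d) =
        List.replicate m ((μ, true) : Letter d) ++ List.replicate (K i - m) ((μ, true) : Letter d) := by
      rw [← List.replicate_add, Nat.add_sub_cancel' hm2]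
    have h3 := build_rowCancels μ (base := i + 2 * K (i + 1) - m + 3)
      (List.replicate (i + 1) ((κ, true) : Letter d) ++ ((κ, true) :: (List.replicate (K (i + 1)) ((μ, true) : Letter d) ++
        (κ, false) :: List.replicate (K (i + 1) - m) ((μ, false) : Letter d))))
      (List.replicate (K i - m) ((μ, true) : Letter d) ++ skylineTail κ μ K i) (by simp; omega) _ m 0
      (by rw [h2, Nat.zero_add, hsplit1, hsplit2]; simp only [List.append_assoc, List.cons_append])
    rw [skylineScript_succ_succ, ← hm, h3, List.replicate_zero, List.replicate_zero, List.nil_append, List.nil_append, skylineWord_succ,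
      skylineTail_succ, ← hm, List.replicate_succ' (n := i + 1)]
    simp

/-- For constant heights the skyline script builds part 1's rectangle word (a second script for the rectangle, with the junction cancels in place of
`NonAbelianStokesRectScript`'s row phase — the same moves). -/
theorem build_skylineScript_const (κ μ : Fin d) (K₀ n : ℕ) : build (skylineScript κ μ (fun _ => K₀) (n + 1)) = rectWord κ μ (n + 1) K₀ := by
  rw [build_skylineScript, skylineWord_const]

end Script

/-! ## §3 The inserted words and where they are glued -/

section Glued

/-- **EVERY WORD INSERTED BY THE SKYLINE SCRIPT IS `plaqWord κ μ`**, `Σ_{i<n} K i` of them. [folklore] -/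
theorem loops_skylineScript (κ μ : Fin d) (K : ℕ → ℕ) : ∀ n : ℕ,
    loops (skylineScript κ μ K n) = List.replicate (∑ i ∈ Finset.range n, K i) (plaqWord κ μ)
  | 0 => by rw [skylineScript, loops, Finset.sum_range_zero, List.replicate_zero]
  | 1 => by
    rw [skylineScript_one, loops_colMoves_append, loops, loops, List.append_nil, Finset.sum_range_one]
  | i + 2 => by
    rw [skylineScript_succ_succ, loops_rowCancels_append, loops_colMoves_append, loops, loops_skylineScript κ μ K (i + 1), ← List.replicate_add,
      Finset.sum_range_succ _ (i + 1), Nat.add_comm]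

/-- Hence every inserted word is literally `plaqWord κ μ`. -/
theorem eq_plaqWord_of_mem_loops_skylineScript (κ μ : Fin d) (K : ℕ → ℕ) (n : ℕ) {σ : List (Letter d)}
    (hσ : σ ∈ loops (skylineScript κ μ K n)) : σ = plaqWord κ μ := by
  rw [loops_skylineScript] at hσ
  exact List.eq_of_mem_replicate hσ

/-- `glued` of the empty script. -/
theorem glued_skylineScript_zero (κ μ : Fin d) (K : ℕ → ℕ) (x : Site d) : glued x (skylineScript κ μ K 0) = [] := rfl

/-- **THE GLUED LOOPS, ONE COLUMN AT A TIME**: column `n` prepends its `K n` plaquettes `∂p_{κμ}(x + ne_κ + je_μ)`, `j = K n − 1, …, 0`. [folklore] -/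
theorem glued_skylineScript_succ (κ μ : Fin d) (K : ℕ → ℕ) (x : Site d) : ∀ n : ℕ,
    glued x (skylineScript κ μ K (n + 1)) =
      ((List.range (K n)).reverse.map fun j : ℕ => (x + (n : ℤ) • e κ + (j : ℤ) • e μ, plaqWord κ μ)) ++ glued x (skylineScript κ μ K n)
  | 0 => by
    have h1 : build [Move.backtrack 0 ((κ, true) : Letter d)] = ([] : List (Letter d)) ++ ((κ, true) :: (κ, false) :: ([] : List (Letter d))) := by
      rw [build, build]; exact apply_backtrack_of_length _ [] [] rfl
    rw [skylineScript_one, glued_colMoves_append κ μ x (n := 0) [] [] rfl (by simp) _ h1 (K 0), glued, glued_skylineScript_zero]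
    simp [glued]
  | i + 1 => by
    have h1 : build (Move.backtrack (i + 1) (κ, true) :: skylineScript κ μ K (i + 1)) =
        List.replicate (i + 1) ((κ, true) : Letter d) ++ ((κ, true) :: (κ, false) ::
          (List.replicate (K i) ((μ, true) : Letter d) ++ skylineTail κ μ K i)) := by
      rw [build, build_skylineScript, skylineWord_succ, apply_backtrack_of_length _ _ _ (List.length_replicate ..)]
      rfl
    rw [skylineScript_succ_succ, glued_rowCancels_append,
      glued_colMoves_append κ μ x (List.replicate (i + 1) ((κ, true) : Letter d)) _ (List.length_replicate ..)
        (by rw [disp_replicate, Letter.vec_true]) _ h1 (K (i + 1)), glued, Nat.cast_add, Nat.cast_one]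

/-- **SUMS OVER THE GLUED LOOPS ARE SKYLINE DOUBLE SUMS** `Σ_{i<n} Σ_{j<K i}`. [folklore] -/
theorem sum_glued_skylineScript {M : Type*} [AddCommMonoid M] (κ μ : Fin d) (K : ℕ → ℕ) (x : Site d)
    (f : (Site d) × List (Letter d) → M) : ∀ n : ℕ,
    ((glued x (skylineScript κ μ K n)).map f).sum =
      ∑ i ∈ Finset.range n, ∑ j ∈ Finset.range (K i), f (x + (i : ℤ) • e κ + (j : ℤ) • e μ, plaqWord κ μ)
  | 0 => by rw [glued_skylineScript_zero, List.map_nil, List.sum_nil, Finset.sum_range_zero]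
  | n + 1 => by
    have hcol : ∀ L : ℕ, (((List.range L).reverse.map fun j : ℕ => (x + (n : ℤ) • e κ + (j : ℤ) • e μ, plaqWord κ μ)).map f).sum =
        ∑ j ∈ Finset.range L, f (x + (n : ℤ) • e κ + (j : ℤ) • e μ, plaqWord κ μ) := by
      intro L
      induction L with
      | zero => simp
      | succ L ihL =>
        rw [Finset.sum_range_succ, ← ihL, List.range_succ, List.reverse_append, List.reverse_singleton, List.singleton_append,
          List.map_cons, List.map_cons, List.sum_cons, add_comm]
    rw [glued_skylineScript_succ, List.map_append, List.sum_append, sum_glued_skylineScript κ μ K x f n, hcol, Finset.sum_range_succ, add_comm]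

end Glued

/-! ## §4 (NAS) for skyline regions from part 3, by name -/

section NAS

variable {G : Type*} [GaugeGroup G] (V : Site d → Fin d → G)

/-- **(NAS) FOR EVERY SKYLINE REGION**: `dist1 V(∂𝓡(x; K, n)) ≤ Σ_{i<n} Σ_{j<K i} dist1 V(∂p_{κμ}(x + ie_κ + je_μ))` —
`NonAbelianStokesDisc.dist1_hol_build_le_sum_plaquettes` at `skylineScript`, read through `build_skylineScript` and `sum_glued_skylineScript`. [folklore] -/
theorem dist1_hol_skylineWord_le_sum (x : Site d) (κ μ : Fin d) (K : ℕ → ℕ) (n : ℕ) :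
    dist1 (hol V x (skylineWord κ μ K n)) ≤
      ∑ i ∈ Finset.range n, ∑ j ∈ Finset.range (K i), dist1 (hol V (x + (i : ℤ) • e κ + (j : ℤ) • e μ) (plaqWord κ μ)) := by
  have hmem : ∀ (ms : List (Move d)) (q : (Site d) × List (Letter d)), q ∈ glued x ms → q.2 ∈ loops ms := by
    intro ms
    induction ms with
    | nil => simp [glued]
    | cons m ms ih =>
      cases m with
      | backtrack k l => simpa [glued, loops] using ih
      | cancel k l => simpa [glued, loops] using ih
      | loop k τ =>
        intro q hq
        rcases List.mem_cons.mp (by simpa [glued] using hq) with h' | h'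
        · simp [loops, h']
        · simp [loops, ih q h']
  have h := dist1_hol_build_le_sum_plaquettes V x (skylineScript κ μ K n) (fun _ => (κ, μ))
    (fun q hq => Or.inl (eq_plaqWord_of_mem_loops_skylineScript κ μ K n (hmem _ q hq)))
  rwa [build_skylineScript, sum_glued_skylineScript κ μ K x (fun q => dist1 (hol V q.1 (plaqWord κ μ)))] at h

end NAS

/-! ## §5 Sanity: an L-shape and a staircase -/

section Sanity

/-- The L-shape with column heights `(2, 1)`: boundary `κ κ · μ · κ̄ · μ · κ̄ · μ̄ μ̄` (up 1, left, UP 1 more to height 2, left, down 2). -/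
example (κ μ : Fin d) :
    skylineWord κ μ (fun i => if i = 0 then 2 else 1) 2 =
      [((κ, true) : Letter d), (κ, true), (μ, true), (κ, false), (μ, true), (κ, false), (μ, false), (μ, false)] := by
  simp [skylineWord, skylineTail]

/-- … and its script builds it (two columns, `2 + 1` plaquettes, one junction cancel). -/
example (κ μ : Fin d) :
    build (skylineScript κ μ (fun i => if i = 0 then 2 else 1) 2) =
      [((κ, true) : Letter d), (κ, true), (μ, true), (κ, false), (μ, true), (κ, false), (μ, false), (μ, false)] := by
  rw [build_skylineScript]; simp [skylineWord, skylineTail]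

/-- The descending staircase `(3, 2, 1)` glues `3 + 2 + 1` plaquettes. -/
example (κ μ : Fin d) : (loops (skylineScript κ μ (fun i => 3 - i) 3)).length = 6 := by
  rw [loops_skylineScript, List.length_replicate]; decide

end Sanity

end Summit.QuantumFields.BalabanUV.T4Continuum.NE7b.NonAbelianStokesSkylineScript
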